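import Literature.AnabelianGeometry.AbsoluteAnabelian.MonoAnalyticArchFunctorialProofs
import Literature.AnabelianGeometry.AbsoluteAnabelian.TMMonoNonVacuity
import Mathlib.Analysis.Real.Pi.Bounds
import HarnessLib

/-!
# [IUTchIII] Theorem 3.11 (i) (Ind1) at `v ∈ 𝕍^arc`, PRINT-LITERAL, part 1: automorphisms of the split topological
# monoid `†𝒟⊢_v ∈ Ob(𝕋𝕄⊢)` LIFT to the universal covering `C~` of `C^×` by a SIGN `±1`, and `−1` is attained
# (complex conjugation of the genuine archimedean split monoid `(𝒪^▷_ℂ, (0,1])`)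

Record file (D-0012) of the abc-iut cell (WAVE-4 D-0067 cone-interior discharge prover, seat abc-iut-w4-d001, gen 6;
home layer L6; D-0079 letter L-K «cone unconditional», row «R9-ARCH»; GO abc-iut-c312-1 15:59:52Z «arch strip part
untyped by design — NOT mine»); TAKES NO SIDE on [IUTchIII] Cor. 3.12. Archimedean twin of abc-iut-c312-1's
`Thm311RealInd1Strip.lean` (print's (Ind1) strip part at `v ∈ 𝕍^non`, p448652), whose signature sequel records verbatim:
«the archimedean strip part — automorphisms of the split monoid `†𝒟⊢_v ∈ Ob(𝕋𝕄⊢)`, [IUTchI] Def. 4.1 (iii) — is NOT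
typed here». The sequel `Thm311RealArchInd1StripCarrier.lean` reads the lifts on abc-iut-c312-5's carrier `K_w` and
proves print's archimedean (Ind1) strip part `= {1, −1}`.

PRINT. [IUTchIII] Thm. 3.11 (i) (kurims p. 154): "(Ind1) the indeterminacies induced by the automorphisms of the
procession of `𝒟⊢`-prime-strips `Prc(ⁿ’°𝒟⊢_T)`". [IUTchI] Def. 4.1 (iii) (b) (kurims p. 96, read on the cell render
`paper:url-690e7b3c6199` p0096): "if `v ∈ 𝕍^arc`, then `†𝒟⊢_v` is an object of the category `𝕋𝕄⊢`"; (iv): "A morphism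
of … `𝒟⊢`-prime-strips is defined to be a collection of morphisms, indexed by `𝕍`, between the various constituent
objects of the prime-strips" — so at `v ∈ 𝕍^arc` an automorphism of the strip is a `𝕋𝕄⊢`-isomorphism
`†𝒟⊢_v ⥲ †𝒟⊢_v`. [AbsTopIII] Def. 5.6 (i) (kurims p. 134): `𝕋𝕄⊢` = pairs `(C, C⃗)` of a topological monoid
`C ≅ 𝒪^▷_ℂ` and a submonoid `C⃗ ⊆ C` (`≅ ℝ_{≥0}`) with `C^× × C⃗ ⥲ C`, morphisms the isomorphisms of topological monoids
`C₁ ⥲ C₂` inducing `C⃗₁ ⥲ C⃗₂` (abc-iut-L4-t3's `TMMono`, `TMMono.Iso`). The action on the log-shell is the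
FUNCTORIALITY of the mono-analytic algorithm ([IUTchIII] Prop. 1.2 (vi); [AbsTopIII] Prop. 5.8 (iv), (v), kurims
p. 140, read on the cell render `paper:url-5493eb38cbb7` p0140): "write `C~ → C^×` for the [pointed] universal covering
of `C^×` … regard `C~` as a topological group [isomorphic to `ℝ`] … `k~(G) := C~ × C~`", "a functorial [i.e., relative
to `𝕋𝕄⊢`] algorithm `Ob(𝕋𝕄⊢) ∋ G ↦ …` … hence also the log-shell
`ℐ(G) := {(a·x, b·x) | x ∈ ℐ_{C~}; a, b ∈ ℝ; a² + b² = 1} ⊆ k~(G)`" — a `𝕋𝕄⊢`-isomorphism `φ` acts on `C^× ≅ 𝕊¹` by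
restriction, on `C~` by THE pointed (continuous, additive) LIFT `φ~` of `φ|_{C^×}`, and on `k~(G) = C~ × C~` diagonally.

TYPED (every constant a landed tree decl; no `Prop`-valued fact, no instance, no notation):
* `Real.coverPt M e t` — the covering coordinate `t ↦ e⁻¹(e^{it}) ∈ C` of abc-iut-w6-d034's / p411667's construction of
  `C~ := ℝ → C^×` for an object `M` of `𝕋𝕄⊢` with chart `e : C ≅ 𝒪^▷_ℂ`;
* `Real.IsCoverLift M e φ L` — «`L : ℝ →+ ℝ` is a continuous additive (= pointed topological-group) LIFT of the
  `𝕋𝕄⊢`-automorphism `φ` of `M` to the universal covering `C~ = ℝ`»: `φ(e⁻¹(e^{it})) = e⁻¹(e^{i·L(t)})`;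
* `Real.archSplitModel` — THE GENUINE archimedean split monoid `(𝒪^▷_ℂ, (0, 1])` of [IUTchI] Ex. 3.4 (ii) / [AbsTopIII]
  Def. 5.6 (i) (abc-iut-L4-t3 proved `Nonempty TMMono` with this very object, `TMMono.nonempty_model`; here NAMED, polar
  decomposition adapted from that proof), and `Real.archSplitModelConj` — its `𝕋𝕄⊢`-automorphism COMPLEX CONJUGATION
  (continuous, multiplicative, fixes the ray `(0, 1]` pointwise).

PROVED:
* `Real.IsCoverLift.exists_sign` — EVERY lift is `t ↦ σ·t`, `σ ∈ {1, −1}` (abc-iut-w6-d034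
  `TMMono.Iso.exists_sign`: `φ|_{C^×}` is `z ↦ z^{±1}`, [AbsTopIII] Rmk. 2.7.3; plus: a continuous `ℝ → 2πℤ` vanishing
  at `0` vanishes — intermediate value theorem), `Real.IsCoverLift.unique` (THE lift: print's "[pointed] universal
  covering … uniquely determined");
* `Real.isCoverLift_refl` (`σ = 1`, the identity of any `M`), **`Real.isCoverLift_conj`** (`σ = −1` IS ATTAINED: complex
  conjugation of `(𝒪^▷_ℂ, (0,1])` lifts to `t ↦ −t`) — so the radial dilations of `C⃗` ([AbsTopIII] Rmk. 5.8.1 (i)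
  "non-rigid") contribute nothing: print builds `k~(G)` from the compact factor `C^×` alone (`(C⃗^{gp})^{cs}` coarsified).

HONEST SCOPE: statements about OUR typed objects (abc-iut-L4-t3's `TMMono`); nothing here asserts or refutes [IUTchIII]
Cor. 3.12. [claim: Mochizuki2012, status: disputed] for every quotation of [IUTchI–III];
[cite: MochizukiAbsTopIII2015, Proposition 5.8 (iv)(v) p.140]; [cite: MochizukiAbsTopIII2015, Def 5.6 (i) p. 134].
typed ≠ proved; instantiated ≠ endorsed.
-/

set_option autoImplicit false

noncomputable section

namespace Summit.ABC.IUTFork.Thm311.Real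

open Literature.AnabelianGeometry.AbsoluteAnabelian Complex
open scoped ComplexConjugate

/-! ## 1. Lifts of `𝕋𝕄⊢`-automorphisms to the universal covering `C~ = ℝ` of `C^×` -/

/-- The covering coordinate of [AbsTopIII] Prop. 5.8 (iv) in abc-iut-w6-d034's / p411667's construction: for an object
`M = (C, C⃗)` of `𝕋𝕄⊢` with chart `e : C ≅ 𝒪^▷_ℂ`, the point `e⁻¹(e^{it}) ∈ C^× ⊆ C` over `t ∈ C~ = ℝ`.
[cite: MochizukiAbsTopIII2015, Proposition 5.8 (iv) p.140] -/
def coverPt (M : TMMono.{0}) (e : M.C ≃* complexIntegralMonoid) (t : ℝ) : M.C :=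
  e.symm ⟨Complex.exp (t * I), exp_mul_I_mem_complexIntegralMonoid t⟩

/-- **A LIFT of the `𝕋𝕄⊢`-automorphism `φ` of `M` to the universal covering `C~ = ℝ`**: a continuous additive
`L : ℝ → ℝ` (an endomorphism of the pointed topological group `C~`) with `φ(e⁻¹(e^{it})) = e⁻¹(e^{i L(t)})` — the map
print's functoriality ("[pointed] universal covering … regarded as a topological group") induces on `C~`.
A predicate with parameters (no fact). [cite: MochizukiAbsTopIII2015, Proposition 5.8 (iv)(v) p.140] -/
def IsCoverLift (M : TMMono.{0}) (e : M.C ≃* complexIntegralMonoid) (φ : TMMono.Iso M M) (L : ℝ →+ ℝ) : Prop :=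
  Continuous L ∧ ∀ t : ℝ, φ.toMulEquiv (coverPt M e t) = coverPt M e (L t)

/-- `1` is not an integer multiple of `2π`. [folklore] -/
theorem one_ne_int_mul_two_pi (m : ℤ) : (1 : ℝ) ≠ m * (2 * Real.pi) := by
  intro h
  have hπ : 3 < Real.pi := Real.pi_gt_three
  rcases lt_trichotomy m 0 with hm | rfl | hm
  · have hm' : (m : ℝ) ≤ -1 := by exact_mod_cast (Int.le_sub_one_iff.mpr hm)
    nlinarith
  · simp at h
  · have hm' : (1 : ℝ) ≤ m := by exact_mod_cast hm
    nlinarith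

/-- A continuous real function with values in `2πℤ` that vanishes at `0` vanishes identically (intermediate value
theorem: between `0` and `2πn`, `n ≠ 0`, lies `±1 ∉ 2πℤ`). [folklore] -/
theorem eq_zero_of_continuous_of_mem_two_pi_int {g : ℝ → ℝ} (hg : Continuous g) (h0 : g 0 = 0)
    (hval : ∀ t, ∃ n : ℤ, g t = n * (2 * Real.pi)) (t : ℝ) : g t = 0 := by
  by_contra hne
  obtain ⟨n, hn⟩ := hval t
  have hπ : 3 < Real.pi := Real.pi_gt_three
  have hn0 : n ≠ 0 := by
    rintro rfl
    simp at hn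
    exact hne hn
  rcases lt_or_gt_of_ne hn0 with hneg | hpos
  · -- `g t ≤ -2π < -1 < 0 = g 0`
    have hn' : (n : ℝ) ≤ -1 := by exact_mod_cast (Int.le_sub_one_iff.mpr hneg)
    have hle : g t ≤ -1 := by rw [hn]; nlinarith
    have hmem : (-1 : ℝ) ∈ Set.Icc (g t) (g 0) := ⟨hle, by rw [h0]; norm_num⟩
    obtain ⟨s, hs⟩ := intermediate_value_univ t 0 hg hmem
    obtain ⟨m, hm⟩ := hval s
    have : (1 : ℝ) = (-m : ℤ) * (2 * Real.pi) := by
      rw [Int.cast_neg, neg_mul, ← hm, hs, neg_neg]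
    exact one_ne_int_mul_two_pi (-m) this
  · -- `g 0 = 0 < 1 < 2π ≤ g t`
    have hn' : (1 : ℝ) ≤ n := by exact_mod_cast hpos
    have hle : 1 ≤ g t := by rw [hn]; nlinarith
    have hmem : (1 : ℝ) ∈ Set.Icc (g 0) (g t) := ⟨by rw [h0]; norm_num, hle⟩
    obtain ⟨s, hs⟩ := intermediate_value_univ 0 t hg hmem
    obtain ⟨m, hm⟩ := hval s
    exact one_ne_int_mul_two_pi m (by rw [← hm, hs])

namespace IsCoverLift

variable {M : TMMono.{0}} {e : M.C ≃* complexIntegralMonoid} {φ : TMMono.Iso M M} {L : ℝ →+ ℝ}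

/-- **EVERY LIFT IS A SIGN**: if `L` lifts the `𝕋𝕄⊢`-automorphism `φ` (bicontinuous chart `e`), then `L(t) = σ·t` with
`σ ∈ {1, −1}` — abc-iut-w6-d034's `TMMono.Iso.exists_sign` (`φ|_{C^×}` is `z ↦ z^{±1}`, [AbsTopIII] Rmk. 2.7.3: `Aut(𝕊¹)`
has order `2`) and the discreteness of the fibres of `ℝ → 𝕊¹`. [cite: MochizukiAbsTopIII2015, Proposition 5.8 (iv)(v) p.140] -/
theorem exists_sign (he : Continuous e) (he' : Continuous e.symm) (h : IsCoverLift M e φ L) :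
    ∃ σ : ℝ, (σ = 1 ∨ σ = -1) ∧ ∀ t : ℝ, L t = σ * t := by
  obtain ⟨σ, hσ, hφ⟩ := φ.exists_sign e he he' e he he'
  refine ⟨σ, hσ, ?_⟩
  -- `e^{i L t} = e^{i σ t}` for every `t`
  have hexp : ∀ t : ℝ, Complex.exp (↑(L t) * I) = Complex.exp (↑(σ * t) * I) := by
    intro t
    have h1 := h.2 t
    rw [coverPt, hφ t, coverPt] at h1
    have h2 := congrArg (fun x : complexIntegralMonoid => (x : ℂ)) (e.symm.injective h1)
    exact h2.symm
  -- hence `L t - σ t ∈ 2πℤ`, continuously in `t`, `= 0` at `t = 0`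
  have hval : ∀ t, ∃ n : ℤ, (L t - σ * t) = n * (2 * Real.pi) := by
    intro t
    obtain ⟨n, hn⟩ := Complex.exp_eq_exp_iff_exists_int.mp (hexp t)
    refine ⟨n, ?_⟩
    have him := congrArg Complex.im hn
    simp only [Complex.mul_im, Complex.ofReal_re, Complex.ofReal_im, Complex.I_re, Complex.I_im, mul_zero, mul_one,
      Complex.add_im, Complex.mul_re, Complex.intCast_re, Complex.intCast_im,
      Complex.re_ofNat, Complex.im_ofNat, sub_zero, zero_mul, add_zero] at him
    linarith
  have hcont : Continuous fun t => L t - σ * t := h.1.sub (continuous_const.mul continuous_id)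
  intro t
  have := eq_zero_of_continuous_of_mem_two_pi_int hcont (by simp) hval t
  linarith

/-- **THE lift**: two lifts of the same automorphism coincide. [cite: MochizukiAbsTopIII2015, Proposition 5.8 (iv) p.140] -/
theorem unique (he : Continuous e) (he' : Continuous e.symm) {L' : ℝ →+ ℝ} (h : IsCoverLift M e φ L)
    (h' : IsCoverLift M e φ L') : L = L' := by
  -- both are signs; the two signs give the same point `e^{iσt}` of `C^×` for every `t`, so they agree at `t = π/2`
  obtain ⟨σ, hσ, hL⟩ := h.exists_sign he he'
  obtain ⟨σ', hσ', hL'⟩ := h'.exists_sign he he'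
  have hpt : coverPt M e (L (Real.pi / 2)) = coverPt M e (L' (Real.pi / 2)) := by rw [← h.2, ← h'.2]
  have hexp : Complex.exp (↑(L (Real.pi / 2)) * I) = Complex.exp (↑(L' (Real.pi / 2)) * I) :=
    congrArg (fun x : complexIntegralMonoid => (x : ℂ)) (e.symm.injective hpt)
  rw [hL, hL'] at hexp
  -- `e^{iπ/2} = i ≠ -i = e^{-iπ/2}`, so the signs agree
  have hI : Complex.exp (↑(Real.pi / 2) * I) = I := by
    rw [show (↑(Real.pi / 2) : ℂ) * I = Real.pi / 2 * I by push_cast; ring, Complex.exp_pi_div_two_mul_I]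
  have hnegI : Complex.exp (↑(-1 * (Real.pi / 2)) * I) = -I := by
    rw [neg_mul, one_mul, Complex.ofReal_neg, neg_mul, Complex.exp_neg, hI, Complex.inv_I]
  have hσσ : σ = σ' := by
    rcases hσ with rfl | rfl <;> rcases hσ' with rfl | rfl
    · rfl
    · exfalso
      rw [one_mul, hI, hnegI] at hexp
      exact Complex.I_ne_zero (by linear_combination hexp / 2)
    · exfalso
      rw [one_mul, hnegI, hI] at hexp
      exact Complex.I_ne_zero (by linear_combination -hexp / 2)
    · rfl
  ext x
  rw [hL x, hL' x, hσσ]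

end IsCoverLift

/-- The identity of any object of `𝕋𝕄⊢` lifts to the identity of `C~` (`σ = 1`). [folklore] -/
theorem isCoverLift_refl (M : TMMono.{0}) (e : M.C ≃* complexIntegralMonoid) :
    IsCoverLift M e (TMMono.Iso.refl M) (AddMonoidHom.id ℝ) :=
  ⟨continuous_id, fun _ => rfl⟩

/-! ## 2. The genuine archimedean split monoid `(𝒪^▷_ℂ, (0,1])` and its complex conjugation -/

/-- The ray `(0, 1] = 𝒪^▷_ℂ ∩ ℝ_{>0}` as a submonoid of `𝒪^▷_ℂ` — the split part `C⃗` of the archimedean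
`𝒟⊢_v = (𝒪^▷, (0,1])` ([IUTchI] Ex. 3.4 (ii); [AbsTopIII] Def. 5.6 (i) "necessarily isomorphic to `ℝ_{≥0}`").
[cite: MochizukiAbsTopIII2015, Def 5.6 (i) p. 134] -/
def archRay : Submonoid complexIntegralMonoid where
  carrier := {x | (x : ℂ).im = 0 ∧ 0 < (x : ℂ).re}
  mul_mem' := by
    rintro a b ⟨ha0, ha1⟩ ⟨hb0, hb1⟩
    refine ⟨?_, ?_⟩
    · show ((a : ℂ) * (b : ℂ)).im = 0
      rw [Complex.mul_im, ha0, hb0, mul_zero, zero_mul, add_zero]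
    · show 0 < ((a : ℂ) * (b : ℂ)).re
      rw [Complex.mul_re, ha0, hb0, mul_zero, sub_zero]
      exact mul_pos ha1 hb1
  one_mem' := ⟨Complex.one_im, by show 0 < ((1 : ℂ)).re; rw [Complex.one_re]; exact one_pos⟩

/-- Membership in the ray, unfolded. [folklore] -/
theorem mem_archRay_iff (x : complexIntegralMonoid) : x ∈ archRay ↔ (x : ℂ).im = 0 ∧ 0 < (x : ℂ).re := Iff.rfl

/-- The polar decomposition `C^× × (0,1] ⥲ 𝒪^▷_ℂ`, `(u, t) ↦ u·t`, is a homeomorphism (inverse `z ↦ (z/‖z‖, ‖z‖)`).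
Adapted from abc-iut-L4-t3's proof of `TMMono.nonempty_model` (same object, there anonymous inside a `Nonempty`).
[cite: MochizukiAbsTopIII2015, Def 5.6 (i) p. 134] -/
theorem isHomeomorph_mul_archRay :
    IsHomeomorph (fun x : (↥complexIntegralMonoid)ˣ × archRay => (x.1 : complexIntegralMonoid) * (x.2 : complexIntegralMonoid)) := by
  classical
  have hP_eq : ∀ t : archRay, ((t : complexIntegralMonoid) : ℂ) = ((((t : complexIntegralMonoid) : ℂ).re : ℝ) : ℂ) := by
    intro t
    obtain ⟨him, -⟩ := (mem_archRay_iff _).1 t.2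
    exact Complex.ext (by simp) (by simp [him])
  have hP_norm : ∀ t : archRay, ‖((t : complexIntegralMonoid) : ℂ)‖ = ((t : complexIntegralMonoid) : ℂ).re := by
    intro t
    obtain ⟨-, hre⟩ := (mem_archRay_iff _).1 t.2
    rw [hP_eq t, Complex.norm_of_nonneg hre.le, Complex.ofReal_re]
  have rad_mem : ∀ z : complexIntegralMonoid,
      (⟨(((‖(z : ℂ)‖ : ℝ) : ℂ)), norm_mem_complexIntegralMonoid z⟩ : complexIntegralMonoid) ∈ archRay := by
    intro z
    rw [mem_archRay_iff]
    exact ⟨Complex.ofReal_im _, by rw [Complex.ofReal_re]; exact complexIntegralMonoid.norm_pos z⟩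
  let rad : complexIntegralMonoid → archRay := fun z => ⟨⟨_, norm_mem_complexIntegralMonoid z⟩, rad_mem z⟩
  let ang : complexIntegralMonoid → (↥complexIntegralMonoid)ˣ := fun z =>
    ⟨⟨(z : ℂ) / ((‖(z : ℂ)‖ : ℝ) : ℂ), div_norm_mem_complexIntegralMonoid z⟩,
      ⟨((‖(z : ℂ)‖ : ℝ) : ℂ) / (z : ℂ), norm_div_mem_complexIntegralMonoid z⟩,
      Subtype.ext (by
        show (z : ℂ) / ((‖(z : ℂ)‖ : ℝ) : ℂ) * (((‖(z : ℂ)‖ : ℝ) : ℂ) / (z : ℂ)) = 1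
        rw [div_mul_div_comm, mul_comm (z : ℂ),
          div_self (mul_ne_zero (complexIntegralMonoid.ofReal_norm_ne_zero z) (complexIntegralMonoid.coe_ne_zero z))]),
      Subtype.ext (by
        show ((‖(z : ℂ)‖ : ℝ) : ℂ) / (z : ℂ) * ((z : ℂ) / ((‖(z : ℂ)‖ : ℝ) : ℂ)) = 1
        rw [div_mul_div_comm, mul_comm ((‖(z : ℂ)‖ : ℝ) : ℂ),
          div_self (mul_ne_zero (complexIntegralMonoid.coe_ne_zero z) (complexIntegralMonoid.ofReal_norm_ne_zero z))])⟩
  have hnormC : Continuous fun z : complexIntegralMonoid => ((‖(z : ℂ)‖ : ℝ) : ℂ) :=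
    Complex.continuous_ofReal.comp (continuous_norm.comp continuous_subtype_val)
  have hrad : Continuous rad := Continuous.subtype_mk (Continuous.subtype_mk hnormC _) _
  have hang : Continuous ang := by
    refine Units.continuous_iff.2 ⟨?_, ?_⟩
    · exact Continuous.subtype_mk (continuous_subtype_val.div hnormC complexIntegralMonoid.ofReal_norm_ne_zero) _
    · exact Continuous.subtype_mk (hnormC.div continuous_subtype_val complexIntegralMonoid.coe_ne_zero) _
  refine isHomeomorph_iff_exists_inverse.2 ⟨?_, fun z => (ang z, rad z), ?_, ?_, hang.prodMk hrad⟩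
  · exact (Units.continuous_val.comp continuous_fst).mul (continuous_subtype_val.comp continuous_snd)
  · rintro ⟨u, t⟩
    have hu : ‖((u : complexIntegralMonoid) : ℂ)‖ = 1 := complexIntegralMonoid.norm_coe_units u
    have hnorm : ‖(((u : complexIntegralMonoid) * (t : complexIntegralMonoid) : complexIntegralMonoid) : ℂ)‖ =
        ((t : complexIntegralMonoid) : ℂ).re := by
      rw [Submonoid.coe_mul, norm_mul, hu, one_mul, hP_norm t]
    have hre : (((t : complexIntegralMonoid) : ℂ).re : ℂ) ≠ 0 := Complex.ofReal_ne_zero.2 ((mem_archRay_iff _).1 t.2).2.ne'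
    refine Prod.ext ?_ ?_
    · refine Units.ext (Subtype.ext ?_)
      show (((u : complexIntegralMonoid) * (t : complexIntegralMonoid) : complexIntegralMonoid) : ℂ) /
          ((‖(((u : complexIntegralMonoid) * (t : complexIntegralMonoid) : complexIntegralMonoid) : ℂ)‖ : ℝ) : ℂ) =
          ((u : complexIntegralMonoid) : ℂ)
      rw [hnorm, Submonoid.coe_mul, ← hP_eq t, mul_div_assoc, div_self (by rw [hP_eq t]; exact hre), mul_one]
    · refine Subtype.ext (Subtype.ext ?_)
      show (((‖(((u : complexIntegralMonoid) * (t : complexIntegralMonoid) : complexIntegralMonoid) : ℂ)‖ : ℝ) : ℂ)) =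
          ((t : complexIntegralMonoid) : ℂ)
      rw [hnorm, ← hP_eq t]
  · intro z
    refine Subtype.ext ?_
    show (z : ℂ) / ((‖(z : ℂ)‖ : ℝ) : ℂ) * ((‖(z : ℂ)‖ : ℝ) : ℂ) = (z : ℂ)
    exact div_mul_cancel₀ _ (complexIntegralMonoid.ofReal_norm_ne_zero z)

/-- **THE GENUINE ARCHIMEDEAN SPLIT MONOID `𝒟⊢_v = (𝒪^▷_ℂ, (0, 1])`** ([IUTchI] Ex. 3.4 (ii) "the object of `𝕋𝕄⊢`
determined by …"; [AbsTopIII] Def. 5.6 (i)/(ii)(c)): abc-iut-L4-t3's `TMMono` structure on `𝒪^▷_ℂ = {0 < ‖z‖ ≤ 1}` with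
`C⃗ := (0, 1]`, chart the identity, `C^× × C⃗ ⥲ C` by `isHomeomorph_mul_archRay`. [cite: MochizukiAbsTopIII2015, Def 5.6 (i) p. 134] -/
def archSplitModel : TMMono.{0} where
  C := complexIntegralMonoid
  pos := archRay
  exists_iso := ⟨MulEquiv.refl _, continuous_id, continuous_id⟩
  isHomeomorph_mul := isHomeomorph_mul_archRay

/-- Complex conjugation preserves `𝒪^▷_ℂ` (it preserves `‖·‖`). [folklore] -/
theorem conj_mem_complexIntegralMonoid (z : complexIntegralMonoid) : conj (z : ℂ) ∈ complexIntegralMonoid := by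
  change 0 < ‖conj (z : ℂ)‖ ∧ ‖conj (z : ℂ)‖ ≤ 1
  rw [Complex.norm_conj]
  exact ⟨complexIntegralMonoid.norm_pos z, complexIntegralMonoid.norm_le_one z⟩

/-- Complex conjugation as a monoid automorphism of `𝒪^▷_ℂ`. [folklore] -/
def conjMonoid : complexIntegralMonoid ≃* complexIntegralMonoid where
  toFun z := ⟨conj (z : ℂ), conj_mem_complexIntegralMonoid z⟩
  invFun z := ⟨conj (z : ℂ), conj_mem_complexIntegralMonoid z⟩
  left_inv z := Subtype.ext (Complex.conj_conj (z : ℂ))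
  right_inv z := Subtype.ext (Complex.conj_conj (z : ℂ))
  map_mul' z w := Subtype.ext (by
    show conj ((z : ℂ) * (w : ℂ)) = conj (z : ℂ) * conj (w : ℂ)
    exact map_mul _ _ _)

/-- Underlying value of `conjMonoid`. [folklore] -/
theorem coe_conjMonoid (z : complexIntegralMonoid) : ((conjMonoid z : complexIntegralMonoid) : ℂ) = conj (z : ℂ) := rfl

/-- Underlying value of `conjMonoid.symm`. [folklore] -/
theorem coe_conjMonoid_symm (z : complexIntegralMonoid) :
    ((conjMonoid.symm z : complexIntegralMonoid) : ℂ) = conj (z : ℂ) := rfl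

/-- `conjMonoid` is continuous. [folklore] -/
theorem continuous_conjMonoid : Continuous conjMonoid :=
  Continuous.subtype_mk (Complex.continuous_conj.comp continuous_subtype_val) _

/-- `conjMonoid.symm` (= `conjMonoid`) is continuous. [folklore] -/
theorem continuous_conjMonoid_symm : Continuous conjMonoid.symm :=
  Continuous.subtype_mk (Complex.continuous_conj.comp continuous_subtype_val) _

/-- **Complex conjugation is a `𝕋𝕄⊢`-automorphism of the archimedean split monoid** `(𝒪^▷_ℂ, (0, 1])`: a bicontinuous
isomorphism of topological monoids fixing the ray `(0, 1]` pointwise. [cite: MochizukiAbsTopIII2015, Def 5.6 (i) p. 134] -/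
def archSplitModelConj : TMMono.Iso archSplitModel archSplitModel where
  toMulEquiv := conjMonoid
  continuous_toFun := continuous_conjMonoid
  continuous_invFun := continuous_conjMonoid_symm
  map_pos := by
    -- conjugation FIXES the ray pointwise
    have hfix : ∀ x : complexIntegralMonoid, x ∈ archRay → conjMonoid x = x := by
      intro x hx
      obtain ⟨him, -⟩ := (mem_archRay_iff x).1 hx
      refine Subtype.ext ?_
      change conj (x : ℂ) = (x : ℂ)
      exact Complex.ext (by rw [Complex.conj_re]) (by rw [Complex.conj_im, him, neg_zero])
    change (conjMonoid : complexIntegralMonoid → complexIntegralMonoid) '' (archRay : Set complexIntegralMonoid) =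
      (archRay : Set complexIntegralMonoid)
    ext z
    constructor
    · rintro ⟨x, hx, rfl⟩
      rw [hfix x hx]
      exact hx
    · intro hz
      exact ⟨z, hz, hfix z hz⟩

/-- **`σ = −1` IS ATTAINED**: complex conjugation of `(𝒪^▷_ℂ, (0,1])` lifts to `t ↦ −t` on `C~ = ℝ` (`conj e^{it} = e^{−it}`).
[cite: MochizukiAbsTopIII2015, Proposition 5.8 (iv)(v) p.140] -/
theorem isCoverLift_conj : IsCoverLift archSplitModel (MulEquiv.refl _) archSplitModelConj (-(AddMonoidHom.id ℝ)) := by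
  refine ⟨continuous_neg, fun t => Subtype.ext ?_⟩
  show conj (Complex.exp (↑t * I)) = Complex.exp (↑(-t) * I)
  rw [← Complex.exp_conj, map_mul, Complex.conj_ofReal, Complex.conj_I, Complex.ofReal_neg]
  ring_nf

end Summit.ABC.IUTFork.Thm311.Real

end
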